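import Summits.Ventures.Crystal3D.Theorems.StickyWulffConstantCoaxialWallLawPayerTransCellPlaneTwoPlateRow
import Summits.Ventures.Crystal3D.Theorems.StickyWulffConstantCoaxialWallLawPayerTransCellPlaneTopGen
import HarnessLib

/-!
# The TWO-PLATE plane-coset translation cell UNDER THE CENSUS ROW at every version (v1/v2)

HONEST FRAMING. Venture `Summits/Ventures/Crystal3D` (cell `crystal3d-full`), helper `--supports` the crux
`CoaxialWallLaw` of `route-Ventures-StickyWulffConstant` (REGISTERED line `WallLedgerF`).  Rung credit; F-C1 not
moved; inputs `KissingGap δ`, `KissingClassification δ` and the row BY NAME.  cf-p1 g28 (xxxviii″):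
`wordNet_trans_payers_ge_plane_row` (`…PayerTransCellPlaneTwoPlateRow`) VERBATIM at version `ver`: bottom pairs
(`wordNet_trans_endPairs_plane_gen ver`) and top pairs pulled back (`wordNet_trans_endPairs_plane_top_gen ver`) are
disjoint (same root: the half-integer invariants clash; different roots: the shape LEMMA X
`word_target_ne_of_roots_ne_shape` — no readings, NARROW movers covered), every pair is an `IsEndPair X ver` of
`S₁ = ⟨G₀, RT⟩`, `S₂ = ⟨G₀, −RT⟩`, and `LocalEndRow ver sF S₁ S₂` bounds their number (`card_endPairs_le_of_localRow`).

* **`wordNet_trans_payers_ge_plane_row_gen`**.  WHAT THIS IS NOT: the assembly (next file); not the census; F-C1 not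
moved.
-/

noncomputable section

namespace Summit.Ventures.Crystal3D.Theorems

open Summit.Ventures.Crystal3D Finset
open Literature.MathematicalPhysics.StatisticalMechanics (fccStacking)
open scoped InnerProductSpace

open scoped Classical in
/-- **The two-plate plane-coset translation cell under the census row, version `ver`.**  See the module docstring. -/
theorem wordNet_trans_payers_ge_plane_row_gen (ver : WordVersion)
    {δ : ℝ} (hg : KissingGap δ) (hc : KissingClassification δ)
    (G₀ : EuclideanSpace ℝ (Fin 3) ≃ₗᵢ[ℝ] EuclideanSpace ℝ (Fin 3))
    {F : List (EuclideanSpace ℝ (Fin 3)) → (EuclideanSpace ℝ (Fin 3) ≃ₗᵢ[ℝ] EuclideanSpace ℝ (Fin 3))}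
    (hF0 : F [] = G₀) (hFc : ∀ μ κ, F (μ :: κ) = ((ℝ ∙ μ)ᗮ.reflection).trans (F κ))
    (RT : Finset (EuclideanSpace ℝ (Fin 3))) (hRT : ∀ r ∈ RT, r ∈ fccSlots ∧ 0 < (G₀ r) 2)
    (sk : EuclideanSpace ℝ (Fin 3) → EuclideanSpace ℝ (Fin 3))
    (s₁ s₂ : EuclideanSpace ℝ (Fin 3))
    (hsk : ∀ r ∈ RT, sk r ∈ fccSlots ∧ ⟪r, sk r⟫_ℝ = 0 ∧ ∀ z : ℤ, ⟪G₀.symm (s₂ - s₁), sk r⟫_ℝ ≠ (z : ℝ) / 2)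
    {sF : ℝ} (hrow : LocalEndRow ver sF ⟨G₀, RT⟩ ⟨G₀, RT.image (fun r : EuclideanSpace ℝ (Fin 3) => -r)⟩)
    (X P₁ P₂ : Finset (EuclideanSpace ℝ (Fin 3))) (R₀ h ρ : ℝ)
    (hR₀ : 10 ≤ R₀) (hh : 0 ≤ h) (hρ : R₀ ≤ ρ)
    (hX : ∀ p ∈ X, ∀ q ∈ X, p ≠ q → 1 ≤ dist p q)
    (hcell : ∀ p ∈ X, -(2 * R₀) ≤ p 2 ∧ p 2 ≤ h + 2 * R₀ ∧ p 0 ^ 2 + p 1 ^ 2 ≤ ρ ^ 2)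
    (hP₁X : P₁ ⊆ X) (hP₂X : P₂ ⊆ X)
    (hP₁ : ∀ p, p ∈ P₁ ↔ (p ∈ (fun q => G₀ q + s₁) '' fccStacking 1 (Real.sqrt (2 / 3)) ∧
      -(2 * R₀) ≤ p 2 ∧ p 2 ≤ -R₀ ∧ p 0 ^ 2 + p 1 ^ 2 ≤ ρ ^ 2))
    (hP₂ : ∀ p, p ∈ P₂ ↔ (p ∈ (fun q => G₀ q + s₂) '' fccStacking 1 (Real.sqrt (2 / 3)) ∧
      h + R₀ ≤ p 2 ∧ p 2 ≤ h + 2 * R₀ ∧ p 0 ^ 2 + p 1 ^ 2 ≤ ρ ^ 2)) :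
    2 * (Real.sqrt 2 * (∑ r ∈ RT, (G₀ r) 2) * Real.pi * ρ ^ 2) -
        24 * (12 * Real.sqrt 2 * Real.pi + 36 * R₀ + 55440) * ρ ≤
      sF * ∑ z ∈ X.filter (fun z => (X.filter fun q => dist z q = 1).card ≤ 11 ∧
          -R₀ - 2 ≤ z 2 ∧ z 2 ≤ h + R₀ + 2), ((12 : ℝ) - ((X.filter fun q => dist z q = 1).card : ℝ)) := by
  obtain ⟨T₁, hflux₁, hTpair₁, hTpay₁, hTwit₁⟩ :=
    wordNet_trans_endPairs_plane_gen ver hg hc G₀ hF0 hFc RT hRT sk s₁ s₂ hsk X P₁ P₂ R₀ h ρ hR₀ hh hρ hX hcell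
      hP₁X hP₂X hP₁ hP₂
  obtain ⟨T₂, hflux₂, hTpair₂, hTpay₂, hTwit₂, hTnat₂⟩ :=
    wordNet_trans_endPairs_plane_top_gen ver hg hc G₀ hF0 hFc RT hRT sk s₁ s₂ hsk X P₁ P₂ R₀ h ρ hR₀ hh hρ hX hcell
      hP₁X hP₂X hP₁ hP₂
  -- (1) the two pair sets are disjoint (verbatim, on the projected witnesses)
  have hdisj : Disjoint T₁ T₂ := by
    rw [Finset.disjoint_left]
    intro bq h₁ h₂
    obtain ⟨r₁, hr₁, ⟨z₁, hz₁⟩, κ₁, d₁, -, hlet₁, hch₁, hob₁, hd₁, -, hmove₁⟩ := hTwit₁ bq h₁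
    have hpat₁ := shape_of_isEndMove hmove₁
    obtain ⟨r₂, hr₂, ⟨z₂, hz₂⟩, κ₂, d₂, hlet₂, hch₂, hob₂, hd₂, hpat₂⟩ := hTwit₂ bq h₂
    by_cases hrr : r₁ = r₂
    · subst hrr
      have e : G₀.symm (s₂ - s₁) = G₀.symm (bq.1 - s₁) - G₀.symm (bq.1 - s₂) := by
        rw [← map_sub]; congr 1; abel
      refine (hsk r₁ hr₁).2.2 (z₁ - z₂) ?_
      rw [e, inner_sub_left, hz₁, hz₂]; push_cast; ring
    · have hr₁S := (hRT r₁ hr₁).1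
      have hr₂S := neg_mem_fccSlots (hRT r₂ hr₂).1
      have hne : r₁ ≠ -r₂ := by
        intro h'
        have h1 := (hRT r₁ hr₁).2
        have h2 := (hRT r₂ hr₂).2
        rw [h', map_neg, PiLp.neg_apply] at h1
        linarith
      have hne' : r₁ ≠ -(-r₂) := by rw [neg_neg]; exact hrr
      exact word_target_ne_of_roots_ne_shape hFc hlet₁ hlet₂ hch₁ hch₂ hr₁S hr₂S hne hne' hob₁ hob₂
        (neg_one_pow_eq_or ℝ κ₁.length) (neg_one_pow_eq_or ℝ κ₂.length) hd₁ hd₂ hpat₁ hpat₂ rfl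
  -- (2) every pair of the union is an END PAIR of the two plate systems
  set S₁ : PlateSystem := ⟨G₀, RT⟩ with hS₁
  set S₂ : PlateSystem := ⟨G₀, RT.image (fun r : EuclideanSpace ℝ (Fin 3) => -r)⟩ with hS₂
  have hFwS : ∀ κ, F κ = S₁.Fw κ := by
    intro κ
    induction κ with
    | nil => rw [hF0]; rfl
    | cons μ κ ih => rw [hFc, ih]; rfl
  set T := T₁.disjUnion T₂ hdisj with hT
  have hEP : ∀ bq ∈ T, IsEndPair X ver S₁ S₂ bq.1 bq.2 := by
    intro bq hbq
    rcases mem_disjUnion.1 hbq with h₁ | h₂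
    · obtain ⟨hb, hq, -, -, -⟩ := hTpair₁ bq h₁
      obtain ⟨r, hr, -, κ, d, hWF, -, -, -, hd, -, hmove⟩ := hTwit₁ bq h₁
      exact ⟨hq, hb, hTpay₁ bq h₁, F κ, d, Or.inl ⟨r, hr, κ, hWF, hFwS κ, by rw [hd, hFwS]⟩, hmove⟩
    · obtain ⟨hb, hq, -, -, -⟩ := hTpair₂ bq h₂
      obtain ⟨G, d, hadm, -, hem⟩ := hTnat₂ bq h₂
      exact ⟨hq, hb, hTpay₂ bq h₂, G, d, Or.inr hadm, hem⟩
  -- (3) the discharge of the local row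
  set PAYW := X.filter (fun z => (X.filter fun q => dist z q = 1).card ≤ 11 ∧
    -R₀ - 2 ≤ z 2 ∧ z 2 ≤ h + R₀ + 2) with hPAYW
  have hTX : ∀ bq ∈ T, bq.1 ∈ X := by
    intro bq hbq
    rcases mem_disjUnion.1 hbq with h' | h'
    · exact (hTpair₁ bq h').1
    · exact (hTpair₂ bq h').1
  have hwin : ∀ bq ∈ T, -R₀ - 1 ≤ bq.1 2 ∧ bq.1 2 ≤ h + R₀ + 1 := by
    intro bq hbq
    rcases mem_disjUnion.1 hbq with h' | h'
    · obtain ⟨-, -, -, h4, h5⟩ := hTpair₁ bq h'; exact ⟨h4, h5.le⟩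
    · obtain ⟨-, -, -, h4, h5⟩ := hTpair₂ bq h'; exact ⟨h4, h5⟩
  have hpayT : ∀ bq ∈ T, (X.filter fun q => dist bq.1 q = 1).card ≤ 11 ∨
      ∃ z₁ ∈ X, ∃ z₂ ∈ X, z₁ ≠ z₂ ∧ dist bq.1 z₁ = 1 ∧ dist bq.1 z₂ = 1 ∧
        (X.filter fun q => dist z₁ q = 1).card ≤ 11 ∧ (X.filter fun q => dist z₂ q = 1).card ≤ 11 := by
    intro bq hbq
    rcases mem_disjUnion.1 hbq with h' | h'
    · exact hTpay₁ bq h'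
    · exact hTpay₂ bq h'
  have hclosed : ∀ bq ∈ T, ∀ z ∈ X, dist bq.1 z ≤ 1 → (X.filter fun q => dist z q = 1).card ≤ 11 → z ∈ PAYW := by
    intro bq hbq z hzX hdz hz11
    obtain ⟨h4, h5⟩ := hwin bq hbq
    have h2 : (z 2 - bq.1 2) ^ 2 ≤ 1 := by
      have := sq_sub_apply_le_dist_sq z bq.1 2
      rw [dist_comm] at hdz; nlinarith [this, hdz, dist_nonneg (x := z) (y := bq.1)]
    have h2' : |z 2 - bq.1 2| ≤ 1 := by rw [← sq_le_one_iff_abs_le_one]; exact h2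
    obtain ⟨ha, hb⟩ := abs_le.1 h2'
    exact mem_filter.2 ⟨hzX, hz11, by linarith, by linarith⟩
  have hpay : ∀ bq ∈ T, ∃ z ∈ X, dist bq.1 z ≤ 1 ∧ (X.filter fun q => dist z q = 1).card ≤ 11 := by
    intro bq hbq
    rcases hpayT bq hbq with h11 | ⟨z₁, hz₁, -, -, -, hd₁, -, hc₁, -⟩
    · exact ⟨bq.1, hTX bq hbq, by rw [dist_self]; norm_num, h11⟩
    · exact ⟨z₁, hz₁, hd₁.le, hc₁⟩
  -- the row's multiplicities dominate the pair counts
  have hmult : ∀ b, ((T.filter fun bq => bq.1 = b).card : ℝ) ≤ (endMult X ver S₁ S₂ b : ℝ) := by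
    intro b
    have : (T.filter fun bq => bq.1 = b).card ≤ (X.filter fun q => IsEndPair X ver S₁ S₂ b q).card := by
      refine card_le_card_of_injOn (fun bq => bq.2) (fun bq hbq => ?_) ?_
      · obtain ⟨hbqT, hb1⟩ := mem_filter.1 hbq
        have hep := hEP bq hbqT
        rw [hb1] at hep
        exact mem_coe.2 (mem_filter.2 ⟨hep.1, hep⟩)
      · intro bq hbq bq' hbq' heq
        obtain ⟨-, hb⟩ := mem_filter.1 (mem_coe.1 hbq)
        obtain ⟨-, hb'⟩ := mem_filter.1 (mem_coe.1 hbq')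
        exact Prod.ext (hb.trans hb'.symm) heq
    exact_mod_cast this
  have hDnn : ∀ b, 0 ≤ pooledDef X b := by
    intro b
    refine sum_nonneg fun z hz => ?_
    have : ((X.filter fun q => dist z q = 1).card : ℝ) ≤ 11 := by exact_mod_cast (mem_filter.1 hz).2.2
    linarith
  have hrow' : ∀ z ∈ PAYW,
      ∑ b ∈ X.filter (fun b => dist z b ≤ 1 ∧ 0 < (T.filter fun bq => bq.1 = b).card),
        ((T.filter fun bq => bq.1 = b).card : ℝ) /
          (∑ z' ∈ X.filter (fun z' => dist b z' ≤ 1 ∧ (X.filter fun q => dist z' q = 1).card ≤ 11),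
            ((12 : ℝ) - ((X.filter fun q => dist z' q = 1).card : ℝ))) ≤ sF := by
    intro z hz
    obtain ⟨hzX, hz11, -, -⟩ := mem_filter.1 hz
    have key := hrow X hX z hzX hz11
    refine le_trans ?_ key
    calc ∑ b ∈ X.filter (fun b => dist z b ≤ 1 ∧ 0 < (T.filter fun bq => bq.1 = b).card),
          ((T.filter fun bq => bq.1 = b).card : ℝ) / pooledDef X b
        ≤ ∑ b ∈ X.filter (fun b => dist z b ≤ 1 ∧ 0 < (T.filter fun bq => bq.1 = b).card),
          (endMult X ver S₁ S₂ b : ℝ) / pooledDef X b :=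
          sum_le_sum fun b _ => div_le_div_of_nonneg_right (hmult b) (hDnn b)
      _ ≤ ∑ b ∈ X.filter (fun b => dist z b ≤ 1 ∧ 0 < endMult X ver S₁ S₂ b),
          (endMult X ver S₁ S₂ b : ℝ) / pooledDef X b := by
          refine sum_le_sum_of_subset_of_nonneg (fun b hb => ?_) fun b _ _ =>
            div_nonneg (Nat.cast_nonneg _) (hDnn b)
          obtain ⟨hbX, hd, hpos⟩ := mem_filter.1 hb
          refine mem_filter.2 ⟨hbX, hd, ?_⟩
          have := hmult b
          have hpos' : (0 : ℝ) < (T.filter fun bq => bq.1 = b).card := by exact_mod_cast hpos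
          exact_mod_cast (show (0 : ℝ) < endMult X ver S₁ S₂ b by linarith)
  have key := card_endPairs_le_of_localRow T PAYW hTX (fun z hz => ⟨(mem_filter.1 hz).1, (mem_filter.1 hz).2.1⟩)
    hclosed hpay hrow'
  rw [hT, card_disjUnion] at key
  have hcast : (T₁.card : ℝ) + (T₂.card : ℝ) ≤ sF * ∑ z ∈ PAYW, ((12 : ℝ) - ((X.filter fun q => dist z q = 1).card : ℝ)) := by
    have : (((T₁.card + T₂.card : ℕ) : ℝ)) = (T₁.card : ℝ) + (T₂.card : ℝ) := by push_cast; ring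
    rw [← this]; exact key
  linarith only [hflux₁, hflux₂, hcast]

end Summit.Ventures.Crystal3D.Theorems

end
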